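import Literature.NumberTheory.Automorphic.OrbitalIntegralChartRealisation   -- ★ F0P3a-p08 (g12): (iv-a) `IsCanonical.exists_isLocSmooth_classOrbitalIntegral_mk_eq_of_chart`, (iv-b)(iv-c)
import Literature.NumberTheory.Rogawski1990.LocalTransferChartJunction          -- ★ p840036 F0P2-p02 (g8): `exists_transfer_of_chart` (the junction this file feeds)
import HarnessLib

/-!
# The H-side of the one-chart junction: the prescribed STABLE orbital integrals on a torus box are REALISED by one `C_c^∞` function, which has vanishing stable
# orbital integrals at every class not stably conjugate into the box (Rogawski 1990 §4.3 (4.3.1), §4.9; Harish-Chandra 1970 Part I §3)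

Topic `NumberTheory/Rogawski1990`; namespace `Literature.NumberTheory.Rogawski1990`.  THEOREMS ONLY (no definition, no instance, no notation, no named fact, no `sorry`); GENERIC
(a locally compact second countable Hausdorff group `G` — the `H`-side carrier `A` of ★ `IsDeltaTransferRel` — with a «stable conjugacy» relation `st` containing conjugacy,
symmetric and transitive).  Cell `pub/hodgecm-mathlib` (D-0151), crux H413 = stmt-HodgeConjecture-24833, F0∕P3a road «D-N6-ns», floor-2 letter N6-ns-reg, brick «(HLOC)
JUNCTION», the `hreal` HALF (LEAD F0P3a-plan (g9) T8-17 (B)(4)); seat F0P2-p02 (g8).  HONEST LABEL: HC_CM is proved only modulo the printed citations until rung 0 closes; this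
file proves no letter.

THE MATHEMATICS.  ★ (iv-a) `OrbitalMeasureFamily.IsCanonical.exists_isLocSmooth_classOrbitalIntegral_mk_eq_of_chart` (F0P3a-p08 (g12)) realises every locally constant torus
function `g` as `b ↦ Φ([τ b], f^H)` by an `f^H ∈ C_c^∞(G)` vanishing off the compact chart image `Ω = e(K × B₁)`.  If moreover stably conjugate box points coincide (`hsep :
st (τ b) (τ b′) ⇒ b = b′` on `B₁` — Weyl separation on a small box, ★ `exists_nhds_forall_conj_eq_imp_mem_centralizer` in the dress) and conjugate elements are `st`-related, then
(§1) every class with non-zero `Φ(·, f^H)` is the class of some `τ b′`, `b′ ∈ B₁` (a conjugate of its representative meets `tsupport f^H ⊆ Ω`, ★ (iv-b)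
`classOrbitalIntegral_mk_eq_zero_of_forall_conj_notMem_tsupport`); hence (§2) the STABLE orbital integral `Φ^st(τ b, f^H)` collapses to `Φ([τ b], f^H) = g b` (★ (iv-c)
`stableOrbitalIntegralRel_eq_classOrbitalIntegral_of_forall_ne`) and `Φ^st(a, f^H) = 0` at every `a` not stably conjugate into `τ(B₁)` (★ `stableOrbitalIntegralRel_eq_zero_of_forall`).
This is exactly the hypothesis `hreal` of the one-chart junction ★ `exists_transfer_of_chart` at the target `g := RHS_ψ ∘ τ` (§3).

* §1 `isCompact_image_prod_of_subset_source`, `exists_mem_mk_eq_of_classOrbitalIntegral_ne_zero`.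
* §2 `OrbitalMeasureFamily.IsCanonical.exists_isLocSmooth_stableOrbitalIntegralRel_eq_of_chart` (THE `hreal` PACKAGE: realisation + collapse + vanishing).
* §3 `OrbitalMeasureFamily.IsCanonical.exists_transfer_of_chart_of_realisation` (the junction fed: a Δ-transfer of `ψ` from the chart data, `hΔst`, the local constancy of
  `RHS_ψ ∘ τ` on the box and the `G′`-side vanishing `hzeroG`).

## References
* [Rogawski1990] J. Rogawski, *Automorphic Representations of Unitary Groups in Three Variables*, Ann. of Math. Stud. 123 (1990): §4.3 (4.3.1) p. 43; §4.9 Prop. 4.9.1 (a) pp. 54–55; §4.1 (4.1.1) p. 39.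
* [HarishChandra1970] Harish-Chandra (notes by G. van Dijk), *Harmonic Analysis on Reductive p-adic Groups*, LNM 162 (1970): Part I §3.
* [LanglandsShelstad1987] R. P. Langlands, D. Shelstad, *On the definition of transfer factors*, Math. Ann. 278 (1987): §1.3.
-/

set_option autoImplicit false

noncomputable section

open Set Filter Topology MeasureTheory Measure
open Literature.MeasureTheory.Group
open scoped Pointwise

namespace Literature.NumberTheory.Rogawski1990

open Literature.NumberTheory.Automorphic

/-! ## §1 Classes with non-zero orbital integral of a chart function are box classes -/

section Classes

variable {G : Type*} [Group G] [TopologicalSpace G] [IsTopologicalGroup G] [T2Space G]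
  {A B : Type*} [TopologicalSpace A] [TopologicalSpace B]

omit [Group G] [IsTopologicalGroup G] [T2Space G] in
/-- The chart image `e(K × B₁)` of a compact box is compact. [cite: HarishChandra1970, Part I §3] -/
theorem isCompact_image_prod_of_subset_source (e : OpenPartialHomeomorph (A × B) G) {K : Set A} (hKc : IsCompact K) {B₁ : Set B}
    (hB₁c : IsCompact B₁) (hKB : K ×ˢ B₁ ⊆ e.source) : IsCompact (e '' (K ×ˢ B₁)) :=
  (hKc.prod hB₁c).image_of_continuousOn (e.continuousOn.mono hKB)

omit [IsTopologicalGroup G] in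
/-- **A class with NON-ZERO orbital integral of a function vanishing off the chart image `e(K × B₁)` is the class of a box point `τ b′`, `b′ ∈ B₁`** (its representative
has a conjugate in `tsupport f ⊆ e(K × B₁)`, ★ `classOrbitalIntegral_mk_eq_zero_of_forall_conj_notMem_tsupport`). [cite: Rogawski1990, §4.9 p. 54] -/
theorem exists_mem_mk_eq_of_classOrbitalIntegral_ne_zero [∀ γ : G, MeasurableSpace (G ⧸ Subgroup.centralizer ({γ} : Set G))]
    (m : OrbitalMeasureFamily G) (e : OpenPartialHomeomorph (A × B) G) (s : A → G) (τ : B → G)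
    (he : ∀ p ∈ e.source, e p = s p.1 * τ p.2 * (s p.1)⁻¹) {K : Set A} (hKc : IsCompact K) {B₁ : Set B} (hB₁c : IsCompact B₁)
    (hKB : K ×ˢ B₁ ⊆ e.source) {f : G → ℂ} (hf0 : ∀ y ∉ e '' (K ×ˢ B₁), f y = 0) {c : ConjClasses G} (hc : classOrbitalIntegral m f c ≠ 0) :
    ∃ b' ∈ B₁, c = ConjClasses.mk (τ b') := by
  classical
  have hts : tsupport f ⊆ e '' (K ×ˢ B₁) :=
    closure_minimal (fun y hy => not_imp_comm.1 (hf0 y) hy) (isCompact_image_prod_of_subset_source e hKc hB₁c hKB).isClosed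
  by_contra hne
  apply hc
  rw [← Quotient.out_eq c]
  refine classOrbitalIntegral_mk_eq_zero_of_forall_conj_notMem_tsupport m fun x hx => ?_
  obtain ⟨p, hp, hpx⟩ := hts hx
  obtain ⟨ha, hb⟩ := Set.mem_prod.1 hp
  apply hne
  refine ⟨p.2, hb, ?_⟩
  rw [← Quotient.out_eq c, ConjClasses.quotient_mk_eq_mk, ConjClasses.mk_eq_mk_iff_isConj, isConj_iff]
  refine ⟨(s p.1)⁻¹ * x, ?_⟩
  rw [he p (hKB hp)] at hpx
  calc (s p.1)⁻¹ * x * Quotient.out c * ((s p.1)⁻¹ * x)⁻¹ = (s p.1)⁻¹ * (x * Quotient.out c * x⁻¹) * s p.1 := by group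
    _ = τ p.2 := by rw [← hpx]; group

end Classes

/-! ## §2 THE `hreal` PACKAGE: realisation with collapsed stable sums and vanishing off the box -/

section Package

variable {G : Type*} [Group G] [TopologicalSpace G] [IsTopologicalGroup G] [LocallyCompactSpace G] [SecondCountableTopology G]
  [T2Space G] [MeasurableSpace G] [BorelSpace G]
  [∀ γ : G, MeasurableSpace (G ⧸ Subgroup.centralizer ({γ} : Set G))]
  [∀ γ : G, BorelSpace (G ⧸ Subgroup.centralizer ({γ} : Set G))]
  {A B : Type*} [TopologicalSpace A] [TopologicalSpace B]

/-- **THE `hreal` PACKAGE.**  In the frame of ★ (iv-a) (canonical `m` for `(P, ν)`, closed `T` with normalised Haar `ρ`, chart `e (a, b) = s a * τ b * (s a)⁻¹` on a compact open box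
`K × B₁ ∋ (a₀, ·)`, `hreg`, (SAT)), with a relation `st` containing conjugacy (`hconj`), symmetric, transitive, and SEPARATING the box (`hsep`): every locally constant `g : B → ℂ` is
realised by some `f^H ∈ C_c^∞(G)` with `Φ^st(τ b, f^H) = g b` for `b ∈ B₁` AND `Φ^st(a, f^H) = 0` at every `a` not `st`-related into `τ(B₁)`.
[cite: Rogawski1990, §4.3 (4.3.1) p. 43; §4.9 p. 54] [cite: HarishChandra1970, Part I §3] -/
theorem _root_.Literature.NumberTheory.Automorphic.OrbitalMeasureFamily.IsCanonical.exists_isLocSmooth_stableOrbitalIntegralRel_eq_of_chart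
    {P : G → Prop} (hP : ∀ g x : G, P g → P (x * g * x⁻¹)) {ν : Measure G} [IsHaarMeasure ν] [ν.IsMulRightInvariant]
    {m : OrbitalMeasureFamily G} (hm : m.IsCanonical P ν)
    (T : Subgroup G) (hTc : IsClosed (T : Set G)) [MeasurableSpace (G ⧸ T)] [BorelSpace (G ⧸ T)]
    (ρ : Measure ↥T) [IsHaarMeasure ρ] [ρ.IsInvInvariant] (hρ : ρ (compactCore ↥T) = 1)
    (e : OpenPartialHomeomorph (A × B) G) (s : A → G) (hs : Continuous s) (τ : B → G)
    (he : ∀ p ∈ e.source, e p = s p.1 * τ p.2 * (s p.1)⁻¹) {K : Set A} (hKc : IsCompact K) (hKo : IsOpen K) {a₀ : A} (ha₀ : a₀ ∈ K)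
    {B₁ : Set B} (hB₁c : IsCompact B₁) (hB₁o : IsOpen B₁) (hKB : K ×ˢ B₁ ⊆ e.source)
    (hreg : ∀ b ∈ B₁, P (τ b) ∧ Subgroup.centralizer ({τ b} : Set G) = T)
    (hsat : ∀ b ∈ B₁, ∀ x : G, x * τ b * x⁻¹ ∈ e '' (K ×ˢ B₁) → x ∈ s '' K * (T : Set G))
    (st : G → G → Prop) (hconj : ∀ a x : G, st a (x * a * x⁻¹)) (hsymm : ∀ a a', st a a' → st a' a)
    (htrans : ∀ a a' a'', st a a' → st a' a'' → st a a'') (hsep : ∀ b ∈ B₁, ∀ b' ∈ B₁, st (τ b) (τ b') → b = b')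
    (g : B → ℂ) (hg : IsLocallyConstant g) :
    ∃ fH : G → ℂ, IsLocSmooth fH ∧ (∀ b ∈ B₁, stableOrbitalIntegralRel st m fH (τ b) = g b) ∧
      ∀ a : G, (∀ b ∈ B₁, ¬ st a (τ b)) → stableOrbitalIntegralRel st m fH a = 0 := by
  obtain ⟨fH, hfH, hf0, hval⟩ := hm.exists_isLocSmooth_classOrbitalIntegral_mk_eq_of_chart hP T hTc ρ hρ e s hs τ he hKc hKo ha₀ hB₁c hB₁o hKB
    hreg hsat g hg
  -- every class related to `a` with non-zero orbital integral is a box class `[τ b']` with `st a (τ b')`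
  have key : ∀ (a : G) (c : ConjClasses G), st a (Quotient.out c) → classOrbitalIntegral m fH c ≠ 0 → ∃ b' ∈ B₁, c = ConjClasses.mk (τ b') ∧ st a (τ b') := by
    intro a c hac hc
    obtain ⟨b', hb', rfl⟩ := exists_mem_mk_eq_of_classOrbitalIntegral_ne_zero m e s τ he hKc hB₁c hKB hf0 hc
    refine ⟨b', hb', rfl, ?_⟩
    -- `out [τ b']` is a conjugate of `τ b'`
    obtain ⟨y, hy⟩ := isConj_iff.1 (ConjClasses.mk_eq_mk_iff_isConj.1 (Quotient.out_eq (ConjClasses.mk (τ b'))).symm)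
    have hst : st (τ b') (Quotient.out (ConjClasses.mk (τ b'))) := by rw [← hy]; exact hconj _ _
    exact htrans _ _ _ hac (hsymm _ _ hst)
  refine ⟨fH, hfH, fun b hb => ?_, fun a ha => ?_⟩
  · -- collapse of the stable sum at `τ b`
    have hc₀ : st (τ b) (Quotient.out (ConjClasses.mk (τ b))) := by
      obtain ⟨y, hy⟩ := isConj_iff.1 (ConjClasses.mk_eq_mk_iff_isConj.1 (Quotient.out_eq (ConjClasses.mk (τ b))).symm)
      rw [← hy]; exact hconj _ _
    rw [stableOrbitalIntegralRel_eq_classOrbitalIntegral_of_forall_ne st m fH (τ b) (ConjClasses.mk (τ b)) hc₀ fun c hc hne => ?_, hval b hb]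
    by_contra hO
    obtain ⟨b', hb', rfl, hst⟩ := key (τ b) c hc hO
    exact hne (by rw [hsep b hb b' hb' hst])
  · exact stableOrbitalIntegralRel_eq_zero_of_forall st m fH a fun c hc => by
      by_contra hO
      obtain ⟨b', hb', -, hst⟩ := key a c hc hO
      exact ha b' hb' hst

end Package

/-! ## §3 The junction fed: a Δ-transfer of `ψ` from the chart realisation -/

section Fed

variable {Acar : Type*} [Group Acar] [TopologicalSpace Acar] [IsTopologicalGroup Acar] [LocallyCompactSpace Acar] [SecondCountableTopology Acar]
  [T2Space Acar] [MeasurableSpace Acar] [BorelSpace Acar]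
  [∀ γ : Acar, MeasurableSpace (Acar ⧸ Subgroup.centralizer ({γ} : Set Acar))]
  [∀ γ : Acar, BorelSpace (Acar ⧸ Subgroup.centralizer ({γ} : Set Acar))]
  {Bcar : Type*} [Group Bcar] [∀ b : Bcar, MeasurableSpace (Bcar ⧸ Subgroup.centralizer ({b} : Set Bcar))]
  {A B : Type*} [TopologicalSpace A] [TopologicalSpace B]

/-- **A Δ-TRANSFER OF `ψ` FROM ONE CHART** (★ `exists_transfer_of_chart` with `hreal` discharged by §2 at `g := RHS_ψ ∘ τ`): `H`-side chart data as in §2 (canonical `m_H`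
for `(regA, ν_H)`), `Δ` stable-left-invariant (`hΔst`), `b ↦ RHS_ψ(τ b) = Σᶠ_{[γ]} Δ(τ b, γ) Φ([γ], ψ)` LOCALLY CONSTANT near each point of the closed box `B₁` (`hlc` — from the
`G′`-side chart local constancy (ii) and the local constancy of `Δ`), and `RHS_ψ(a) = 0` at the `G`-regular `a` not stably conjugate into the box (`hzeroG`).  Then `ψ` has a
Δ-transfer in `C_c^∞(H)`. [cite: Rogawski1990, §4.9 Prop. 4.9.1 (a) pp. 54–55; §4.3 (4.3.1) p. 43] [cite: LanglandsShelstad1987, §1.3] -/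
theorem _root_.Literature.NumberTheory.Automorphic.OrbitalMeasureFamily.IsCanonical.exists_transfer_of_chart_of_realisation
    {R : Acar → Bcar → Prop} {stA : Acar → Acar → Prop} {regA : Acar → Prop} {T : TransferFactorData Acar Bcar R}
    {mH : OrbitalMeasureFamily Acar} {mG : OrbitalMeasureFamily Bcar}
    (hP : ∀ g x : Acar, regA g → regA (x * g * x⁻¹)) {νH : Measure Acar} [IsHaarMeasure νH] [νH.IsMulRightInvariant] (hm : mH.IsCanonical regA νH)
    (Tz : Subgroup Acar) (hTc : IsClosed (Tz : Set Acar)) [MeasurableSpace (Acar ⧸ Tz)] [BorelSpace (Acar ⧸ Tz)]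
    (ρ : Measure ↥Tz) [IsHaarMeasure ρ] [ρ.IsInvInvariant] (hρ : ρ (compactCore ↥Tz) = 1)
    (e : OpenPartialHomeomorph (A × B) Acar) (s : A → Acar) (hs : Continuous s) (τ : B → Acar)
    (he : ∀ p ∈ e.source, e p = s p.1 * τ p.2 * (s p.1)⁻¹) {K : Set A} (hKc : IsCompact K) (hKo : IsOpen K) {a₀ : A} (ha₀ : a₀ ∈ K)
    {B₁ : Set B} (hB₁c : IsCompact B₁) (hB₁o : IsOpen B₁) (hKB : K ×ˢ B₁ ⊆ e.source)
    (hreg : ∀ b ∈ B₁, regA (τ b) ∧ Subgroup.centralizer ({τ b} : Set Acar) = Tz)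
    (hsat : ∀ b ∈ B₁, ∀ x : Acar, x * τ b * x⁻¹ ∈ e '' (K ×ˢ B₁) → x ∈ s '' K * (Tz : Set Acar))
    (hconj : ∀ a x : Acar, stA a (x * a * x⁻¹)) (hsymm : ∀ a a', stA a a' → stA a' a)
    (htrans : ∀ a a' a'', stA a a' → stA a' a'' → stA a a'') (hsep : ∀ b ∈ B₁, ∀ b' ∈ B₁, stA (τ b) (τ b') → b = b')
    (hΔst : ∀ (a a' : Acar) (b : Bcar), stA a a' → T.Δ a' b = T.Δ a b)
    (ψ : Bcar → ℂ) (hB₁cl : IsClosed B₁)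
    (hlc : ∀ b ∈ B₁, ∀ᶠ b' in 𝓝 b, ∑ᶠ c : ConjClasses Bcar, T.Δ (τ b') (Quotient.out c) * classOrbitalIntegral mG ψ c =
      ∑ᶠ c : ConjClasses Bcar, T.Δ (τ b) (Quotient.out c) * classOrbitalIntegral mG ψ c)
    (hzeroG : ∀ a, regA a → (∀ b ∈ B₁, ¬ stA a (τ b)) → ∑ᶠ c : ConjClasses Bcar, T.Δ a (Quotient.out c) * classOrbitalIntegral mG ψ c = 0) :
    ∃ ψH : Acar → ℂ, IsLocSmooth ψH ∧ IsDeltaTransferRel R stA regA T mH mG ψH ψ := by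
  -- the target torus function: `RHS_ψ ∘ τ` on the box, `0` off it (locally constant since `B₁` is clopen)
  set g : B → ℂ := B₁.indicator fun b => ∑ᶠ c : ConjClasses Bcar, T.Δ (τ b) (Quotient.out c) * classOrbitalIntegral mG ψ c with hg_def
  have hg : IsLocallyConstant g := by
    rw [IsLocallyConstant.iff_eventually_eq]
    intro b
    by_cases hb : b ∈ B₁
    · filter_upwards [hlc b hb, hB₁o.mem_nhds hb] with b' hb' hb'₁
      rw [hg_def, Set.indicator_of_mem hb'₁, Set.indicator_of_mem hb, hb']
    · filter_upwards [hB₁cl.isOpen_compl.mem_nhds hb] with b' hb'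
      rw [hg_def, Set.indicator_of_notMem hb', Set.indicator_of_notMem hb]
  obtain ⟨fH, hfH, hbox, hzero⟩ := hm.exists_isLocSmooth_stableOrbitalIntegralRel_eq_of_chart hP Tz hTc ρ hρ e s hs τ he hKc hKo ha₀ hB₁c hB₁o hKB hreg hsat
    stA hconj hsymm htrans hsep g hg
  refine exists_transfer_of_chart hsymm htrans hΔst IsLocSmooth τ B₁ ψ ⟨fH, hfH, fun b hb => ?_, fun a _ ha => hzero a ha⟩ hzeroG
  rw [hbox b hb, hg_def, Set.indicator_of_mem hb]

end Fed

/-! ## §4 (ED. 2, append-only) FINITELY MANY BOXES: one `ψ`, several NON-stably-conjugate preimage boxes (e.g. the three `H`-preimages of a `U(3)`-class of type `(E¹)³`) -/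

section Boxes

variable {Acar : Type*} [Group Acar]
  [∀ γ : Acar, MeasurableSpace (Acar ⧸ Subgroup.centralizer ({γ} : Set Acar))]
  {Bcar : Type*} [Group Bcar] [∀ b : Bcar, MeasurableSpace (Bcar ⧸ Subgroup.centralizer ({b} : Set Bcar))]

/-- **`Φ^st(a, ·)` is additive over finite sums of `C_c^∞` functions at a regular `a`** (Finset induction over the binary additivity `hA` — the glue's side condition,
at CM ★ `localStableOrbitalIntegralH_add_of_isLocSmooth`). [cite: Rogawski1990, §4.3 (4.3.1) p. 43] -/
theorem stableOrbitalIntegralRel_finset_sum_of_isLocSmooth [TopologicalSpace Acar] {stA : Acar → Acar → Prop} {regA : Acar → Prop}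
    (mH : OrbitalMeasureFamily Acar)
    (hA : ∀ a, regA a → ∀ F G : Acar → ℂ, IsLocSmooth F → IsLocSmooth G →
      stableOrbitalIntegralRel stA mH (F + G) a = stableOrbitalIntegralRel stA mH F a + stableOrbitalIntegralRel stA mH G a)
    {a : Acar} (ha : regA a) {J : Type*} (s : Finset J) (F : J → Acar → ℂ) (hF : ∀ j ∈ s, IsLocSmooth (F j)) :
    stableOrbitalIntegralRel stA mH (∑ j ∈ s, F j) a = ∑ j ∈ s, stableOrbitalIntegralRel stA mH (F j) a := by
  classical
  induction s using Finset.induction_on with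
  | empty => rw [Finset.sum_empty, Finset.sum_empty, stableOrbitalIntegralRel_zero]
  | insert i s hi ih =>
    rw [Finset.sum_insert hi, Finset.sum_insert hi,
      hA a ha _ _ (hF i (Finset.mem_insert_self i s)) (IsLocSmooth.finset_sum s fun j hj => hF j (Finset.mem_insert_of_mem hj)),
      ih fun j hj => hF j (Finset.mem_insert_of_mem hj)]

/-- **A Δ-TRANSFER OF `ψ` FROM FINITELY MANY BOXES.**  Boxes `(τ_j, B_j)` (`j ∈ J` finite; `B_j` clopen in its coordinate space) at REGULAR points, PAIRWISE NOT stably conjugate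
(`hsepJ`), each with the `H`-side realisation package of §2 (`hrealJ j` — e.g. ★ `IsCanonical.exists_isLocSmooth_stableOrbitalIntegralRel_eq_of_chart` at box `j`'s chart datum);
`Φ^st` additive on `C_c^∞` at regular points (`hA`); `Δ` stable-left-invariant (`hΔst`); `RHS_ψ ∘ τ_j` locally constant near each point of `B_j` (`hlc`), and `RHS_ψ(a) = 0` at the
regular `a` stably conjugate into NO box (`hzeroG`).  Then `ψ` has a Δ-transfer in `C_c^∞(H)`: `ψ^H := Σ_j f^H_j` (this is the case of SEVERAL `H`-preimages of one `G′`-stable class,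
e.g. `|W_G|∕|W_H| = 3` boxes for a `U(3)`-class of type `(E¹)³`; `J = ∅` gives `ψ^H = 0` for a class matching no `γ_H`).
[cite: Rogawski1990, §4.3 (4.3.1)–(4.3.2) p. 43; §4.9 Prop. 4.9.1 (a) pp. 54–55] [cite: LanglandsShelstad1987, §1.3] -/
theorem exists_transfer_of_boxes_of_realisation [TopologicalSpace Acar]
    {R : Acar → Bcar → Prop} {stA : Acar → Acar → Prop} {regA : Acar → Prop} {T : TransferFactorData Acar Bcar R}
    {mH : OrbitalMeasureFamily Acar} {mG : OrbitalMeasureFamily Bcar}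
    (hsymm : ∀ a a', stA a a' → stA a' a) (htrans : ∀ a a' a'', stA a a' → stA a' a'' → stA a a'')
    (hΔst : ∀ (a a' : Acar) (b : Bcar), stA a a' → T.Δ a' b = T.Δ a b)
    (hA : ∀ a, regA a → ∀ F G : Acar → ℂ, IsLocSmooth F → IsLocSmooth G →
      stableOrbitalIntegralRel stA mH (F + G) a = stableOrbitalIntegralRel stA mH F a + stableOrbitalIntegralRel stA mH G a)
    {J : Type*} [Fintype J] {Bch : J → Type*} [∀ j, TopologicalSpace (Bch j)]
    (τ : ∀ j, Bch j → Acar) (Bb : ∀ j, Set (Bch j)) (hBo : ∀ j, IsOpen (Bb j)) (hBcl : ∀ j, IsClosed (Bb j))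
    (hregτ : ∀ j, ∀ b ∈ Bb j, regA (τ j b))
    (hsepJ : ∀ j j', j ≠ j' → ∀ b ∈ Bb j, ∀ b' ∈ Bb j', ¬ stA (τ j b) (τ j' b'))
    (hrealJ : ∀ j (g : Bch j → ℂ), IsLocallyConstant g → ∃ fH : Acar → ℂ, IsLocSmooth fH ∧
      (∀ b ∈ Bb j, stableOrbitalIntegralRel stA mH fH (τ j b) = g b) ∧ ∀ a : Acar, (∀ b ∈ Bb j, ¬ stA a (τ j b)) → stableOrbitalIntegralRel stA mH fH a = 0)
    (ψ : Bcar → ℂ)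
    (hlc : ∀ j, ∀ b ∈ Bb j, ∀ᶠ b' in 𝓝 b, ∑ᶠ c : ConjClasses Bcar, T.Δ (τ j b') (Quotient.out c) * classOrbitalIntegral mG ψ c =
      ∑ᶠ c : ConjClasses Bcar, T.Δ (τ j b) (Quotient.out c) * classOrbitalIntegral mG ψ c)
    (hzeroG : ∀ a, regA a → (∀ j, ∀ b ∈ Bb j, ¬ stA a (τ j b)) → ∑ᶠ c : ConjClasses Bcar, T.Δ a (Quotient.out c) * classOrbitalIntegral mG ψ c = 0) :
    ∃ ψH : Acar → ℂ, IsLocSmooth ψH ∧ IsDeltaTransferRel R stA regA T mH mG ψH ψ := by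
  classical
  -- the box targets `g_j := 1_{B_j} · (RHS_ψ ∘ τ_j)` are locally constant (`B_j` clopen)
  have hg : ∀ j, IsLocallyConstant ((Bb j).indicator fun b => ∑ᶠ c : ConjClasses Bcar, T.Δ (τ j b) (Quotient.out c) * classOrbitalIntegral mG ψ c) := by
    intro j
    rw [IsLocallyConstant.iff_eventually_eq]
    intro b
    by_cases hb : b ∈ Bb j
    · filter_upwards [hlc j b hb, (hBo j).mem_nhds hb] with b' hb' hb'₁
      rw [Set.indicator_of_mem hb'₁, Set.indicator_of_mem hb, hb']
    · filter_upwards [(hBcl j).isOpen_compl.mem_nhds hb] with b' hb'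
      rw [Set.indicator_of_notMem hb', Set.indicator_of_notMem hb]
  choose fH hfH hbox hzero using fun j => hrealJ j _ (hg j)
  -- a box point of box `j` is stably conjugate into no OTHER box
  have hoff : ∀ j, ∀ b ∈ Bb j, ∀ i, i ≠ j → ∀ b' ∈ Bb i, ¬ stA (τ j b) (τ i b') := fun j b hb i hij b' hb' => hsepJ j i (Ne.symm hij) b hb b' hb'
  refine ⟨∑ j, fH j, IsLocSmooth.finset_sum _ (fun j _ => hfH j),
    isDeltaTransferRel_of_chart hsymm htrans hΔst (Bx := Σ j, Bch j) (fun p => τ p.1 p.2) {p | p.2 ∈ Bb p.1} ψ _ ?_ ?_ ?_⟩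
  · -- box identity: only box `j`'s own term survives
    rintro ⟨j, b⟩ hb
    change b ∈ Bb j at hb
    rw [stableOrbitalIntegralRel_finset_sum_of_isLocSmooth mH hA (hregτ j b hb) Finset.univ fH (fun i _ => hfH i),
      Finset.sum_eq_single j (fun i _ hij => hzero i (τ j b) (hoff j b hb i hij)) (fun h => absurd (Finset.mem_univ j) h),
      hbox j b hb, Set.indicator_of_mem hb]
  · -- vanishing at a regular `a` matching no box
    intro a ha hno
    rw [stableOrbitalIntegralRel_finset_sum_of_isLocSmooth mH hA ha Finset.univ fH (fun i _ => hfH i)]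
    exact Finset.sum_eq_zero fun i _ => hzero i a fun b' hb' => hno ⟨i, b'⟩ hb'
  · -- the `G′`-side vanishing, re-indexed
    exact fun a ha hno => hzeroG a ha fun j b hb => hno ⟨j, b⟩ hb

end Boxes

/-! ## §5 (ED. 3, append-only) RE-COORDINATISED BOXES: the realisation package of §2 read through a homeomorphism of the torus coordinate
(the junction's `τ_j := τ ∘ φ_j` with `φ_j = θ_j⁻¹ : Z_{G′}(γ₀′) ≃ₜ Z_H(t_j)`, design v2) on a compact open SUB-box -/

section Recoord

variable {G : Type*} [Group G] [TopologicalSpace G] [IsTopologicalGroup G] [LocallyCompactSpace G] [SecondCountableTopology G]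
  [T2Space G] [MeasurableSpace G] [BorelSpace G]
  [∀ γ : G, MeasurableSpace (G ⧸ Subgroup.centralizer ({γ} : Set G))]
  [∀ γ : G, BorelSpace (G ⧸ Subgroup.centralizer ({γ} : Set G))]
  {A B Tc : Type*} [TopologicalSpace A] [TopologicalSpace B] [TopologicalSpace Tc]

/-- **THE `hreal` PACKAGE IN TRANSPORTED COORDINATES ON A SUB-BOX.**  Same chart datum as §2 (box `K × B₁`, `hreg`, (SAT), `st` with `hconj hsymm htrans`, `hsep` on `B₁`); a homeomorphism
`φ : Tc ≃ₜ B` of coordinate spaces and a compact open `BG ⊆ Tc` with `φ(BG) ⊆ B₁`.  Then every locally constant `g : Tc → ℂ` is realised by some `f^H ∈ C_c^∞(G)` with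
`Φ^st(τ (φ b), f^H) = g b` on `BG` and `Φ^st(a, f^H) = 0` at every `a` not `st`-related into `τ(φ(BG))` — i.e. the junction's `hrealJ j` for `τ_j := τ ∘ φ`
(§2 applied to the chart `e ∘ (id × φ)` on the box `K × BG`; (SAT)∕`hreg`∕`hsep` restrict to the sub-box). [cite: Rogawski1990, §4.3 (4.3.1) p. 43; §4.9 p. 54] [cite: HarishChandra1970, Part I §3] -/
theorem _root_.Literature.NumberTheory.Automorphic.OrbitalMeasureFamily.IsCanonical.exists_isLocSmooth_stableOrbitalIntegralRel_eq_of_chart_comp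
    {P : G → Prop} (hP : ∀ g x : G, P g → P (x * g * x⁻¹)) {ν : Measure G} [IsHaarMeasure ν] [ν.IsMulRightInvariant]
    {m : OrbitalMeasureFamily G} (hm : m.IsCanonical P ν)
    (T : Subgroup G) (hTc : IsClosed (T : Set G)) [MeasurableSpace (G ⧸ T)] [BorelSpace (G ⧸ T)]
    (ρ : Measure ↥T) [IsHaarMeasure ρ] [ρ.IsInvInvariant] (hρ : ρ (compactCore ↥T) = 1)
    (e : OpenPartialHomeomorph (A × B) G) (s : A → G) (hs : Continuous s) (τ : B → G)
    (he : ∀ p ∈ e.source, e p = s p.1 * τ p.2 * (s p.1)⁻¹) {K : Set A} (hKc : IsCompact K) (hKo : IsOpen K) {a₀ : A} (ha₀ : a₀ ∈ K)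
    {B₁ : Set B} (hKB : K ×ˢ B₁ ⊆ e.source)
    (hreg : ∀ b ∈ B₁, P (τ b) ∧ Subgroup.centralizer ({τ b} : Set G) = T)
    (hsat : ∀ b ∈ B₁, ∀ x : G, x * τ b * x⁻¹ ∈ e '' (K ×ˢ B₁) → x ∈ s '' K * (T : Set G))
    (st : G → G → Prop) (hconj : ∀ a x : G, st a (x * a * x⁻¹)) (hsymm : ∀ a a', st a a' → st a' a)
    (htrans : ∀ a a' a'', st a a' → st a' a'' → st a a'') (hsep : ∀ b ∈ B₁, ∀ b' ∈ B₁, st (τ b) (τ b') → b = b')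
    (φ : Tc ≃ₜ B) {BG : Set Tc} (hBGc : IsCompact BG) (hBGo : IsOpen BG) (hBG : φ '' BG ⊆ B₁)
    (g : Tc → ℂ) (hg : IsLocallyConstant g) :
    ∃ fH : G → ℂ, IsLocSmooth fH ∧ (∀ b ∈ BG, stableOrbitalIntegralRel st m fH (τ (φ b)) = g b) ∧
      ∀ a : G, (∀ b ∈ BG, ¬ st a (τ (φ b))) → stableOrbitalIntegralRel st m fH a = 0 := by
  -- the transported chart `e' (a, c) = e (a, φ c)` on the box `K × BG`
  set e' : OpenPartialHomeomorph (A × Tc) G := ((Homeomorph.refl A).prodCongr φ).transOpenPartialHomeomorph e with he'_def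
  have he'app : ∀ p : A × Tc, e' p = e (p.1, φ p.2) := fun p => rfl
  have he'src : ∀ p : A × Tc, p ∈ e'.source ↔ (p.1, φ p.2) ∈ e.source := fun p => Iff.rfl
  have hKB' : K ×ˢ BG ⊆ e'.source := fun p hp =>
    (he'src p).2 (hKB (Set.mk_mem_prod (Set.mem_prod.1 hp).1 (hBG ⟨p.2, (Set.mem_prod.1 hp).2, rfl⟩)))
  have he' : ∀ p ∈ e'.source, e' p = s p.1 * τ (φ p.2) * (s p.1)⁻¹ := fun p hp => by
    rw [he'app]; exact he (p.1, φ p.2) ((he'src p).1 hp)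
  -- the transported image is inside the original one
  have himg : e' '' (K ×ˢ BG) ⊆ e '' (K ×ˢ B₁) := by
    rintro y ⟨p, hp, rfl⟩
    exact ⟨(p.1, φ p.2), Set.mk_mem_prod (Set.mem_prod.1 hp).1 (hBG ⟨p.2, (Set.mem_prod.1 hp).2, rfl⟩), (he'app p).symm⟩
  have hregT : ∀ c ∈ BG, P ((τ ∘ φ) c) ∧ Subgroup.centralizer ({(τ ∘ φ) c} : Set G) = T := fun c hc => hreg (φ c) (hBG ⟨c, hc, rfl⟩)
  have hsatT : ∀ c ∈ BG, ∀ x : G, x * (τ ∘ φ) c * x⁻¹ ∈ e' '' (K ×ˢ BG) → x ∈ s '' K * (T : Set G) :=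
    fun c hc x hx => hsat (φ c) (hBG ⟨c, hc, rfl⟩) x (himg hx)
  have hsepT : ∀ c ∈ BG, ∀ c' ∈ BG, st ((τ ∘ φ) c) ((τ ∘ φ) c') → c = c' := fun c hc c' hc' h =>
    φ.injective (hsep (φ c) (hBG ⟨c, hc, rfl⟩) (φ c') (hBG ⟨c', hc', rfl⟩) h)
  exact hm.exists_isLocSmooth_stableOrbitalIntegralRel_eq_of_chart hP T hTc ρ hρ e' s hs (τ ∘ φ) he' hKc hKo ha₀ hBGc hBGo hKB'
    hregT hsatT st hconj hsymm htrans hsepT g hg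

end Recoord

end Literature.NumberTheory.Rogawski1990

end
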